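import Summits.QuantumFields.QCD.Theses.PauliWegnerSea
import Literature.MathematicalPhysics.QuantumFieldTheory.StrongCouplingActivities
import Literature.MathematicalPhysics.QuantumFieldTheory.QCDPhaseQuenched
import Literature.Analysis.Approximation.CarberyWrightProofs
import Literature.Analysis.Complex.CartanLemma
import Literature.Analysis.Fourier.TrigPolyNikolskii
import Literature.Analysis.Fourier.TrigPolySmallBall

/-!
# Crux `TiltedFlatness` (stmt-QuantumFields-14070), line `circle-transport` — stub `stub_circleEngine`

The ONE-DIMENSIONAL ENGINE of the line: for a NON-NEGATIVE real trigonometric polynomial of degree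
`≤ D` in exponential form, `↑(f t) = ∑_{k=-D}^{D} a_k e^{ikt}`,

* (N) **Nikolskii's inequality** `f(t) ≤ (2D+1) ⨍ f`, `⨍ f = (∫_{[-π,π]} f)/(2π)`, and
* (SB) **mean-relative small balls** `|{t ∈ [-π,π] : f(t) ≤ ε ⨍ f}| ≤ C ε^c` with `C, c > 0` depending
  on `D` only (here `c = 1/(2D+2)`),

consumed by `stub_torusSmallBalls` (slice induction on `[-π,π]^m`). Both conjuncts are generic
harmonic analysis and are PROVED in the Literature tree; this file is the registered wrapper:

* (N) = `Literature.Analysis.Fourier.trigPoly_nikolskii` (`Literature/Analysis/Fourier/TrigPolyNikolskii.lean`):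
  orthogonality `∫_{[-π,π]} e^{int} = 2π δ_{n0}` gives `a_k = (1/2π) ∫ f e^{-ik·}`, hence `|a_k| ≤ ⨍ f`
  (`f ≥ 0`), and `f = |∑ a_k e^{ik·}| ≤ ∑ |a_k| ≤ (2D+1) ⨍ f`.
* (SB) = `Literature.Analysis.Fourier.trigPoly_smallBall` (`Literature/Analysis/Fourier/TrigPolySmallBall.lean`):
  `f` is continuous and `2π`-periodic, so `⨍ f ≤ max f = f(t*)`, `t* ∈ [-π, π]`; on each of the three
  arcs `[c - 2π/3, c + 2π/3]`, `c ∈ {t*, t* ± 2π/3}`, the half-angle chart `t = c + 2 arctan u`,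
  `|u| ≤ √3`, turns `f(t)(1+u²)^D` into a real polynomial `R(u)` of degree `≤ 2D`, and the sublevel-set
  form of the PROVED weak Remez inequality `Literature.Analysis.Approximation.CarberyWright.remez_weak`
  (degree bound `2D+2`, interval `[-√3, √3]`, `|R| ≤ ε f(t*) 4^D` on the sublevel set, `R(u₀) ≥ f(t*)`
  at the chart point of `t*`) bounds the chart-side sublevel set by `16e√3 (2e 4^D ε)^{1/(2D+2)}`; the
  `2`-Lipschitz chart at most doubles Lebesgue measure, and `[-π, π]` is covered by the period
  `[t* - π, t* + π]` and its translates by `±2π` (periodicity + translation invariance). Constant: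
  `C = 288 e √3 (2e 4^D)^{1/(2D+2)}`.

Sources: S. M. Nikolskii (1951), see P. Borwein, T. Erdélyi, *Polynomials and Polynomial
Inequalities*, GTM 161, §5.1 (Remez- and Nikolskii-type inequalities) and §6.1; E. J. Remez (1936);
A. Carbery, J. Wright, Math. Res. Lett. 8 (2001) 233–248 [CarberyWright2001], Lemma 4.
-/

noncomputable section

namespace Summit.QuantumFields.QCD.Theorems.CircleTransport

open scoped BigOperators Real Matrix.Norms.L2Operator
open MeasureTheory Set Filter
open Literature.MathematicalPhysics.QuantumFieldTheory Literature.MathematicalPhysics.QuantumLattice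
  Literature.Probability.LatticeModels

/-- `SU(3)` (the tree's `Matrix.specialUnitaryGroup (Fin 3) ℂ`). -/
local notation "SU3" => Matrix.specialUnitaryGroup (Fin 3) ℂ

/-- STUB 4 (N + SB, size M; the 1-D engine): Nikolskii's inequality and mean-relative small balls for
non-negative trigonometric polynomials. -/
theorem stub_circleEngine :
    (∀ (D : ℕ) (f : ℝ → ℝ),
      (∃ a : ℤ → ℂ, ∀ t : ℝ, ((f t : ℝ) : ℂ) =
        ∑ k ∈ Finset.Icc (-(D : ℤ)) D, a k * Complex.exp ((k : ℂ) * (t : ℂ) * Complex.I)) →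
      (∀ t, 0 ≤ f t) → ∀ t : ℝ, f t ≤ (2 * D + 1) * ((∫ s in Set.Icc (-π) π, f s) / (2 * π))) ∧
    (∀ D : ℕ, ∃ C c : ℝ, 0 < C ∧ 0 < c ∧ ∀ f : ℝ → ℝ,
      (∃ a : ℤ → ℂ, ∀ t : ℝ, ((f t : ℝ) : ℂ) =
        ∑ k ∈ Finset.Icc (-(D : ℤ)) D, a k * Complex.exp ((k : ℂ) * (t : ℂ) * Complex.I)) →
      (∀ t, 0 ≤ f t) → 0 < ∫ t in Set.Icc (-π) π, f t → ∀ ε : ℝ, 0 < ε →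
        volume {t ∈ Set.Icc (-π) π | f t ≤ ε * ((∫ s in Set.Icc (-π) π, f s) / (2 * π))} ≤
          ENNReal.ofReal (C * ε ^ c)) :=
  ⟨Literature.Analysis.Fourier.trigPoly_nikolskii, Literature.Analysis.Fourier.trigPoly_smallBall⟩

end Summit.QuantumFields.QCD.Theorems.CircleTransport
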